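import Summits.BirchSwinnertonDyer.Rank1Residual.Additive.LocalPreimageCardSignedTwist
import Summits.BirchSwinnertonDyer.Rank1Residual.Additive.StrictSignedDualTorsionRankOne
import HarnessLib

/-!
# THE SELMER SIDE OF (C3_η) IN RANK ONE WITHOUT THE KITAJIMA–OTSUKI INPUT, EXACTLY:
# **`#Sel^{loc,∞}(W/ℚ) = #Ш(W)[p^∞] · p^{2ν} · ∏_{ℓ ∈ T} p^{ord_p c_ℓ(W)}`** (no dual datum at all) and
# **`p^{ord_p f(0)} · #X^{−,str}[T] = #Ш(W)[p^∞] · p^{2ν} · ∏_{ℓ ∈ T} p^{ord_p c_ℓ(W)}`** for EVERY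
# strict-minus dual datum — the defect of the `hnf`-free formula is EXACTLY `#X[T] = #H¹(Γ, Sel^{−,str}_∞)`
# (cell `b2b-bsdres`, CLASS-CLOSURE lane, class O10 — x1b GEN 44, class lead; file 121 of the series)

HONEST FRAMING (cell `b2b-bsdres`, run/shared/lean/b2b/bsd-rank1-residual/, verbatim in every
file): the goal of the cell is to DELETE the COMBINATION-SHAPED residual classes of the
Birch–Swinnerton-Dyer formula for ALL analytic-rank `≤ 1` elliptic curves over `ℚ` — "full BSD
formula for every rank `≤ 1` curve in class `C`" assembled STRICTLY from published theorems — so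
that the rank-`≤ 1` remainder becomes exactly the CONSTRUCTION-SHAPED classes, which are TYPED
(missing-input `Prop`s), NOT attempted. This is not "finishing BSD". CLASS-CLOSURE lane: prove
what is provable now; shrink each hard class to its core with data; no claim beyond stated classes;
research routes on CONSTRUCTION-SHAPED X12 / O10; census / instrument output = EVIDENCE / conjecture
items, NEVER a Literature fact; `RESIDUAL-MAP.md` marks change only by signed lines. THIS FILE:
TOOL THEOREMS ONLY — no definition, no named Literature fact, no Summits-side fact `def … : Prop`,
no `sorry`, axioms standard; CONDITIONAL (hypothesis `hPT`) on the NAMED FACT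
`poitouTate_selmerStructure_duality_real ℚ` exactly as files 107, 108, 117–120, and on the INPUTS
displayed (`Ш(W)[p^∞]` finite — Gross–Zagier–Kolyvagin in the application; a generator modulo torsion
of exact level `ν`); NOT conditional on the absence of finite `Λ`-submodules (`hnf`, the
Kitajima–Otsuki reading) — that input is REMOVED here and its exact contribution displayed. Nothing
is booked; no label / mark / count / sub-cell moves; nothing about (C1_η), (C2_η-GZ), (C3_η) as typed,
or `BSD(W, p)` of any pair, is claimed.

## What

`W` is the `(−1)^{p/2}p`-twist of a globally minimal `V/ℚ` with good reduction at the odd prime `p`,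
`a_p(V) = 0`, `W` `p`-integral, `κ` the cyclotomic `ℤ_p`-extension; `A₀ = Sel^{loc,∞}(W/ℚ)` is the
group of classes in `H¹(ℚ, W[p^∞])` whose restriction to `ℚ_∞` lies in `Sel_{p^∞}(W/ℚ_∞)` and in the
strict-minus Kummer condition `⋃ₙ E^{−,str}(ℚ_{n,p})` at every conjugate of the embedding at `p`
(`= h₀⁻¹(Sel^{−,str}(W/ℚ_∞))`, B2 of file 49). GIVEN `hPT`, a generator `P` of `W(ℚ)` modulo torsion of
exact level `ν` in `W(ℚ_p)`, `Ш(W)[p^∞]` finite, `T ∌ (p)` finite containing the `ℓ ≠ p` with `p ∣ c_ℓ(W)`: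

* `card_localPreimage_eq_card_sha_mul_of_quadraticTwist_signedPrime_rankOne` (NO dual datum):
  **`#Sel^{loc,∞}(W/ℚ) = #Ш(W)[p^∞] · (p^{2ν} · ∏_{ℓ ∈ T} p^{ord_p c_ℓ(W)})`** — `A₀` is finite by file 118
  ((hMW) discharged), hence of order `p^a`; file 120 §2 at the level `m = a + 2ν + e + ∑ s_ℓ + ∑ ord_p c_ℓ + 1`
  (every level-`m` input from file 109) and gen 30's `#Sel_str(W/ℚ)[p^∞] = p^ν · #Ш[p^∞]`.
* `pow_constantCoeff_mul_natCard_invariants_eq_card_sha_mul_of_quadraticTwist_signedPrime_rankOne`: for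
  EVERY strict-minus dual datum `D` (topological generator `γ`) with `char(X) = (f)`:
  **`p^{ord_p f(0)} · #X[T] = #Ш(W)[p^∞] · (p^{2ν} · ∏_{ℓ ∈ T} p^{ord_p c_ℓ(W)})`** — file 120 §1
  (`f(0)·#X[T] = u·#A₀`, `#X[T] = p^b`) + the previous theorem + `ord_p f(0) + b = a`.
* hence `p^{ord_p f(0)} ∣ #Ш(W)[p^∞]·p^{2ν}·∏ p^{ord_p c_ℓ}` with NO no-finite-submodule input
  (`pow_constantCoeff_dvd_…`: ONE INEQUALITY of the Selmer side of (C3_η), `hnf`-free); EQUALITY iff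
  `X[T] = 0` (`card_sha_mul_eq_pow_iff_invariants_eq_bot_…`); `hnf ⟹ X[T] = 0` (`X[T]` is a finite
  `Λ`-submodule: `invariants_eq_bot_of_noFiniteSubmodule_…`), recovering file 119's formula
  (`card_sha_mul_eq_pow_of_noFiniteSubmodule_…`) by a second route. By Pontryagin duality
  `#X[T] = #H¹(Γ, Sel^{−,str}(W/ℚ_∞))`: the Kitajima–Otsuki input (Main Thm. 1.3 read on `D`) of the
  (C3_η) Selmer side is isolated as the vanishing of this ONE finite group — necessary and sufficient.

References: [GreenbergLNM1716] §3 (pp. 85–90), §4 Thm. 4.1 and Lemma 4.2 (p. 102); [Kobayashi2003]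
Thm. 9.3 (p. 26); [MilneADT2006] I Thm. 4.10; [CoatesSchneiderSujatha2003] §3 (30)–(31);
[SilvermanAEC2009] Prop. VII.6.3; [KitajimaOtsuki2018] Main Thm. 1.3 (what `hnf` reads; NOT used here).
-/

noncomputable section

open scoped Classical

open CategoryTheory Field Function NumberField IsDedekindDomain WeierstrassCurve
open Literature.NumberTheory.EllipticCurves
open Literature.NumberTheory.GaloisRepresentations
open Literature.NumberTheory.GaloisRepresentations.DiscreteGaloisModule (SelmerStructure)
open Literature.NumberTheory.GaloisCohomology
open Literature.NumberTheory.EllipticCurves.Kobayashi2003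
open Literature.NumberTheory.EllipticCurves.IwasawaAlgebra
open Literature.NumberTheory.EllipticCurves.IwasawaDual
open Summit.BirchSwinnertonDyer.Rank1Residual.X11b.Levels
open Summit.BirchSwinnertonDyer.Rank1Residual.X11b
open scoped ContRepresentation

universe u

-- Over `ℚ` two `ℚ`-algebra structures on a completion are in scope; the general-`K` statements must be
-- met by the completion's own (the device of files 78, 107, 108, 118, 120).
attribute [local instance 10000] IsDedekindDomain.HeightOneSpectrum.instAlgebraAdicCompletion
  NumberField.Place.instAlgebraCompletion

namespace Summit.BirchSwinnertonDyer.Rank1Residual.Additive.LevelBridge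

variable (W : WeierstrassCurve ℚ) [W.IsElliptic] {p : ℕ} [hp : Fact p.Prime] (κ : ZpExtension ℚ p)
  [hint : (W.baseChange ℚ_[p]).IsIntegral ℤ_[p]]

/-! ## §3 Rank one, level-free -/

section RankOne

variable
    (hp2 : p ≠ 2) (hκ : κ.IsCyclotomic) (Cv : VariableChange ℚ) (V : WeierstrassCurve ℚ)
    [V.IsElliptic] [V.IsGloballyMinimal] (hCV : Cv • W.quadraticTwist ((-1) ^ (p / 2) * p) = V)
    (hgood : V.HasGoodReductionAtPrime p) (hap : V.frobeniusTrace p = 0)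
    (hPT : poitouTate_selmerStructure_duality_real ℚ)
    (P : W.toAffine.Point) (hP : ¬ IsOfFinAddOrder P)
    (hgen : ∀ R : W.toAffine.Point, ∃ (k : ℤ) (T : W.toAffine.Point), IsOfFinAddOrder T ∧ R = k • P + T)
    {ν : ℕ}
    (hdiv : ∃ Q : (W.baseChange ℚ_[p]).toAffine.Point,
      p ^ ν • Q = Affine.Point.baseChange (W' := W) ℚ ℚ_[p] P)
    (hndiv : ∀ Q : (W.baseChange ℚ_[p]).toAffine.Point,
      p ^ (ν + 1) • Q ≠ Affine.Point.baseChange (W' := W) ℚ ℚ_[p] P)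
    [hSha : Finite (AddCommGroup.primaryComponent W.sha p)]
    (T : Finset (HeightOneSpectrum (𝓞 ℚ)))
    (hpT : (Rat.HeightOneSpectrum.primesEquiv (R := 𝓞 ℚ)).symm ⟨p, hp.out⟩ ∉ T)
    (hT : ∀ v : HeightOneSpectrum (𝓞 ℚ), v ≠ (Rat.HeightOneSpectrum.primesEquiv (R := 𝓞 ℚ)).symm ⟨p, hp.out⟩ →
      p ∣ (W.baseChange (v.adicCompletion ℚ)).localTamagawaNumber (v.adicCompletionIntegers ℚ) → v ∈ T)

include hp2 hκ hCV hgood hap hPT hP hgen hdiv hndiv hSha hpT hT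

/-- **`#Sel^{loc,∞}(W/ℚ) = #Ш(W)[p^∞] · (p^{2ν} · ∏_{ℓ ∈ T} p^{ord_p c_ℓ(W)})` — NO dual datum, NO `hnf`.**
For the `(−1)^{p/2}p`-twist `W` of a globally minimal `V/ℚ` with good reduction at the odd prime `p`,
`a_p(V) = 0` (`W` `p`-integral, `κ` cyclotomic), GIVEN: the named fact `hPT`; `P ∈ W(ℚ)` of infinite
order generating `W(ℚ)` modulo torsion, of exact level `ν` in `W(ℚ_p)`; `Ш(W)[p^∞]` finite; a finite
`T ∌ (p)` containing every `ℓ ≠ p` with `p ∣ c_ℓ(W)`: the group `Sel^{loc,∞}(W/ℚ)` of global classes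
satisfying the LEVEL-`∞` strict-minus local conditions has order EXACTLY
`#Ш(W)[p^∞] · p^{2ν} · ∏_{ℓ∈T} p^{ord_p c_ℓ(W)}`.  Proof: `Sel^{loc,∞}(W/ℚ)` is FINITE (file 118, (hMW)
discharged), hence of order `p^a` (`H¹(ℚ, W[p^∞])` is `p`-primary); §2 at the level
`m = a + 2ν + e + ∑ s_ℓ + ∑ ord_p c_ℓ + 1` with every level-`m` input supplied by file 109 ((kill),
(MW) from the generator with `W(ℚ)[p] = 0` by file 55, (Ш) exponent, (loc) along `ℚ_[p] ≃ ℚ_{v₀}`,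
B4 cyclotomic); then gen 30's `#Sel_str(W/ℚ)[p^∞] = p^ν · #Ш[p^∞]`.  CONDITIONAL on `hPT`; nothing
about (C1_η), (C2_η-GZ), (C3_η) as typed, or `BSD(W, p)`, is claimed; nothing booked.
[cite: GreenbergLNM1716, §3 Lemma 3.1–3.3 (pp. 85–90), §4 Thm. 4.1] [cite: Kobayashi2003, Thm. 9.3 (p. 26)]
[cite: MilneADT2006, Ch. I, Thm. 4.10] [cite: SilvermanAEC2009, Prop. VII.6.3] -/
theorem card_localPreimage_eq_card_sha_mul_of_quadraticTwist_signedPrime_rankOne :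
    Nat.card ↥((W.selmerInfty κ ⊓ ⨅ σ : absoluteGaloisGroup ℚ,
        (localKummerOverOfEmb W p κ.kerSubgroup (closureEmb (K := ℚ) ℚ_[p])
          (⨆ n, strictSignedLocalPoints κ ℚ_[p] W (-1) n)).comap
            (W.conjH1 p κ.kerSubgroup σ)).comap (W.layerToInfty κ 0)) =
      Nat.card (AddCommGroup.primaryComponent W.sha p) *
        (p ^ (2 * ν) * ∏ w ∈ T, p ^ padicValNat p ((W.baseChange (w.adicCompletion ℚ)).localTamagawaNumber
          (w.adicCompletionIntegers ℚ))) := by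
  set v₀ := (Rat.HeightOneSpectrum.primesEquiv (R := 𝓞 ℚ)).symm ⟨p, hp.out⟩ with hv₀def
  set A := (W.selmerInfty κ ⊓ ⨅ σ : absoluteGaloisGroup ℚ,
      (localKummerOverOfEmb W p κ.kerSubgroup (closureEmb (K := ℚ) ℚ_[p])
        (⨆ n, strictSignedLocalPoints κ ℚ_[p] W (-1) n)).comap
          (W.conjH1 p κ.kerSubgroup σ)).comap (W.layerToInfty κ 0) with hAdef
  obtain ⟨Q, hPQ⟩ := hdiv
  -- a topological generator (only needed to invoke file 118)
  obtain ⟨γ, hγ⟩ : ∃ γ : absoluteGaloisGroup ℚ, κ.IsTopGenerator γ := κ.surjective (Multiplicative.ofAdd 1)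
  -- `A₀` is finite (file 118), hence `#A₀ = p^a`
  haveI hAfin : Finite A := finite_localPreimage_of_quadraticTwist_signedPrime_rankOne W κ hp2 hκ Cv V hCV
    hgood hap hPT P hP hgen hPQ hndiv T hpT hT hγ
  have hprim : ∀ y : A, ∃ k : ℕ, p ^ k • y = 0 := fun y ↦ by
    obtain ⟨k, hk⟩ := W.exists_pow_smul_subgroupH1_layer_eq_zero κ 0 (y : W.subgroupH1 p (κ.layerSubgroup 0))
    exact ⟨k, Subtype.ext (by rw [AddSubgroupClass.coe_nsmul, hk, ZeroMemClass.coe_zero])⟩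
  obtain ⟨a, ha⟩ : ∃ a : ℕ, Nat.card A = p ^ a := by
    have hG : IsPGroup p (Multiplicative A) := fun x ↦ by
      obtain ⟨k, hk⟩ := hprim (Multiplicative.toAdd x)
      refine ⟨k, ?_⟩
      apply Multiplicative.toAdd.injective
      rw [toAdd_pow, toAdd_one]
      exact hk
    obtain ⟨a, ha⟩ := IsPGroup.iff_card.mp hG
    exact ⟨a, by rw [← ha]; exact (Nat.card_congr Multiplicative.toAdd).symm⟩
  -- places: `p ∈ w ↔ w = v₀`
  have hpw : ∀ w : HeightOneSpectrum (𝓞 ℚ), w ≠ v₀ → (p : 𝓞 ℚ) ∉ w.asIdeal := fun w hw h ↦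
    hw ((natCast_mem_asIdeal_iff_eq_primesEquiv_symm w hp.out).mp h)
  have hpT' : ∀ w ∈ T, (p : 𝓞 ℚ) ∉ w.asIdeal := fun w hw ↦ hpw w fun h ↦ hpT (h ▸ hw)
  -- no `p`-torsion in `W(ℚ_p)` (file 55), hence in `W(ℚ)`
  obtain ⟨M₀, hΔ, hA, hVM₀⟩ := exists_goodSupersingularPadicModel hp2 V hgood hap
  have htorsX := eq_zero_of_prime_smul_eq_zero_padic_of_quadraticTwist_signedPrime hp2 W Cv hCV M₀ hΔ hA hVM₀
  have htorsQ : ∀ R : W.toAffine.Point, p • R = 0 → R = 0 := fun R hR ↦ by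
    have h1 : Affine.Point.map (W' := W) (Algebra.ofId ℚ ℚ_[p]) (p • R) = 0 := by
      rw [hR]; exact map_zero _
    have h2 : p • Affine.Point.map (W' := W) (Algebra.ofId ℚ ℚ_[p]) R = 0 :=
      (map_nsmul (Affine.Point.map (W' := W) (Algebra.ofId ℚ ℚ_[p])) p R).symm.trans h1
    exact Affine.Point.map_injective (W' := W) (f := Algebra.ofId ℚ ℚ_[p])
      ((htorsX _ h2).trans (map_zero _).symm)
  -- (kill): the bounds `s_w` (file 109 §1)
  have hkill0 : ∀ w : HeightOneSpectrum (𝓞 ℚ), ∃ s : ℕ, (p : 𝓞 ℚ) ∉ w.asIdeal →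
      ∀ m k : ℕ, s ≤ k → ∀ x ∈ W.kummerSelmerStructure ((p ^ m : ℕ) : ℤ) (Sum.inr w), p ^ k • x = 0 := by
    intro w
    by_cases h : (p : 𝓞 ℚ) ∈ w.asIdeal
    · exact ⟨0, fun h' ↦ absurd h h'⟩
    · obtain ⟨s, hs⟩ := exists_pow_smul_kummerSelmerStructure_inr_eq_zero W h
      exact ⟨s, fun _ ↦ hs⟩
  choose s hs using hkill0
  -- (Ш): the exponent `e` (file 109 §3)
  obtain ⟨e, he⟩ := exists_exponent_of_finite_primaryComponent W.sha hSha
  -- the local Tamagawa exponents and the level `m`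
  obtain ⟨c, hc⟩ : ∃ c : HeightOneSpectrum (𝓞 ℚ) → ℕ, ∀ w, c w =
      padicValNat p ((W.baseChange (w.adicCompletion ℚ)).localTamagawaNumber (w.adicCompletionIntegers ℚ)) :=
    ⟨_, fun _ ↦ rfl⟩
  have hcle : ∀ w ∈ T, c w ≤ ∑ w ∈ T, c w := fun w hw ↦
    Finset.single_le_sum (fun _ _ ↦ Nat.zero_le _) hw
  have hsle : ∀ w ∈ T, s w ≤ ∑ w ∈ T, s w := fun w hw ↦
    Finset.single_le_sum (fun _ _ ↦ Nat.zero_le _) hw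
  obtain ⟨m, hm⟩ : ∃ m : ℕ, m = a + 2 * ν + e + (∑ w ∈ T, s w) + (∑ w ∈ T, c w) + 1 := ⟨_, rfl⟩
  -- (MW) at level `m` (file 109 §2)
  obtain ⟨hgenm, hordm⟩ := rankOne_level_inputs (p := p) hP hgen htorsQ m
  -- (loc): the exact level, transported along `ℚ_[p] ≃ ℚ_{v₀}` (file 109 §4)
  obtain ⟨eq⟩ : Nonempty (ℚ_[p] ≃A[ℚ] v₀.adicCompletion ℚ) := ⟨Padic.adicCompletionEquiv (𝓞 ℚ) ⟨p, hp.out⟩⟩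
  obtain ⟨Qv, hPQv⟩ := exists_nsmul_eq_baseChange_of_algHom W ℚ_[p] (v₀.adicCompletion ℚ)
    (eq : ℚ_[p] →ₐ[ℚ] v₀.adicCompletion ℚ) P (p ^ ν) ⟨Q, hPQ⟩
  have hexact : ∀ Q' : (W.baseChange (v₀.adicCompletion ℚ)).toAffine.Point,
      p ^ (ν + 1) • Q' ≠ Affine.Point.baseChange (W' := W) ℚ (v₀.adicCompletion ℚ) P := fun Q' hQ' ↦ by
    obtain ⟨Q'', hQ''⟩ := exists_nsmul_eq_baseChange_of_algHom W (v₀.adicCompletion ℚ) ℚ_[p]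
      ((eq.symm : v₀.adicCompletion ℚ ≃A[ℚ] ℚ_[p]) : v₀.adicCompletion ℚ →ₐ[ℚ] ℚ_[p]) P (p ^ (ν + 1))
      ⟨Q', hQ'⟩
    exact hndiv Q'' hQ''
  -- §2 at the level `m`
  have h := card_localPreimage_eq_mul_of_quadraticTwist_signedPrime W κ (m := m) (by omega) hp2 hκ Cv V
    hCV hgood hap hPT v₀ rfl (a := a) (by rw [← hAdef, ha]) T hpT
    (fun v hv hne ↦ localTowerKerPrimary_eq_bot_of_not_dvd_localTamagawaNumber W hκ (hpw v hne)
      fun hd ↦ hv (hT v hne hd))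
    hpT' (fun w hw ↦ (hc w) ▸ (hcle w hw).trans (by omega)) P hgenm hordm (fun x hx hmx ↦ he x hx m hmx) hPQv
    hexact
    (fun w hw x hx ↦ hs w (hpT' w hw) m _ ((hsle w hw).trans (by omega)) x hx) (by omega) (by omega)
  rw [← hAdef] at h
  rw [h, StrictSha.strictSelmerIndexAt_holds W p P ν hP hgen htorsX ⟨Q, hPQ⟩ hndiv]
  ring

/-- **`p^{ord_p f(0)} · #X^{−,str}[T] = #Ш(W)[p^∞] · (p^{2ν} · ∏_{ℓ ∈ T} p^{ord_p c_ℓ(W)})` for EVERY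
strict-minus dual datum — the Selmer side of (C3_η) in rank one with the Kitajima–Otsuki input
REMOVED and its contribution DISPLAYED.**  Same setting and inputs as the previous theorem (`hPT`,
generator of exact level `ν`, `Ш(W)[p^∞]` finite, `T`), `γ` a topological generator and `D` ANY strict
signed dual datum of `Sel^{−,str}(W/ℚ_∞)` at the model `ℚ_[p]` with `char(X) = (f)`: `X` is f.g.
`Λ`-torsion (file 118), `X[T] = {x : T·x = 0}` is finite, and `p^{ord_p f(0)} · #X[T]` is EXACTLY
`#Ш(W)[p^∞] · p^{2ν} · ∏ p^{ord_p c_ℓ}` — §1 (`f(0)·#X[T] = u·#A₀`, `#X[T] = p^b`) with §3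
(`#A₀ = p^a = #Ш·p^{2ν}·Tam_T`) and valuation bookkeeping (`ord_p f(0) + b = a`).  By Pontryagin
duality `#X[T] = #H¹(Γ, Sel^{−,str}(W/ℚ_∞))`: the `hnf` input of files 108/119 (Kitajima–Otsuki 2018
Main Thm. 1.3 read on `D`) contributes EXACTLY the vanishing of this one finite group.  CONDITIONAL on
`hPT`; nothing about (C1_η), (C2_η-GZ), (C3_η) as typed, or `BSD(W, p)`, is claimed; nothing booked.
[cite: GreenbergLNM1716, §4 Thm. 4.1 and Lemma 4.2 (p. 102)] [cite: Kobayashi2003, Thm. 9.3 (p. 26)]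
[cite: MilneADT2006, Ch. I, Thm. 4.10] [cite: CoatesSchneiderSujatha2003, §3 (30)–(31)] -/
theorem pow_constantCoeff_mul_natCard_invariants_eq_card_sha_mul_of_quadraticTwist_signedPrime_rankOne
    {γ : absoluteGaloisGroup ℚ} (hγ : κ.IsTopGenerator γ) (D : StrictSignedSelmerDualData W κ ℚ_[p] γ (-1))
    {f : IwasawaAlgebra p} (hf : D.charIdeal = Ideal.span {f}) :
    p ^ (((PowerSeries.constantCoeff f : ℤ_[p]) : ℚ_[p]).valuation).toNat * Nat.card (invariants p D.X) =
      Nat.card (AddCommGroup.primaryComponent W.sha p) *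
        (p ^ (2 * ν) * ∏ w ∈ T, p ^ padicValNat p ((W.baseChange (w.adicCompletion ℚ)).localTamagawaNumber
          (w.adicCompletionIntegers ℚ))) := by
  have hcard := card_localPreimage_eq_card_sha_mul_of_quadraticTwist_signedPrime_rankOne W κ hp2 hκ Cv V hCV
    hgood hap hPT P hP hgen hdiv hndiv T hpT hT
  obtain ⟨Q, hPQ⟩ := hdiv
  obtain ⟨hMF, hX, hord0⟩ := isTorsion_and_constantCoeff_ne_zero_of_quadraticTwist_signedPrime_rankOne W κ hp2
    hκ Cv V hCV hgood hap hPT P hP hgen hPQ hndiv T hpT hT hγ D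
  haveI := hMF
  haveI hAfin := finite_localPreimage_of_quadraticTwist_signedPrime_rankOne W κ hp2 hκ Cv V hCV
    hgood hap hPT P hP hgen hPQ hndiv T hpT hT hγ
  obtain ⟨-, ⟨b, hb⟩, u, hu⟩ :=
    StrictSignedControlZero.constantCoeff_mul_natCard_invariants_eq_of_quadraticTwist_signedPrime κ W (-1) hp2
      Cv V hCV hgood hap hγ D hX hf
  -- `#A₀ = p^a`
  set N := Nat.card (AddCommGroup.primaryComponent W.sha p) *
    (p ^ (2 * ν) * ∏ w ∈ T, p ^ padicValNat p ((W.baseChange (w.adicCompletion ℚ)).localTamagawaNumber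
      (w.adicCompletionIntegers ℚ))) with hN
  have hNpow : ∃ a : ℕ, N = p ^ a := by
    haveI := hSha
    have hprimSha : ∀ x : AddCommGroup.primaryComponent W.sha p, ∃ k : ℕ, p ^ k • x = 0 := fun x ↦ by
      obtain ⟨k, hk⟩ := AddCommGroup.mem_primaryComponent.mp x.2
      exact ⟨k, Subtype.ext (by rw [AddSubmonoidClass.coe_nsmul, hk, ZeroMemClass.coe_zero])⟩
    obtain ⟨a₁, ha₁⟩ : ∃ a₁ : ℕ, Nat.card (AddCommGroup.primaryComponent W.sha p) = p ^ a₁ := by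
      have hG : IsPGroup p (Multiplicative (AddCommGroup.primaryComponent W.sha p)) := fun x ↦ by
        obtain ⟨k, hk⟩ := hprimSha (Multiplicative.toAdd x)
        refine ⟨k, ?_⟩
        apply Multiplicative.toAdd.injective
        rw [toAdd_pow, toAdd_one]
        exact hk
      obtain ⟨a₁, ha₁⟩ := IsPGroup.iff_card.mp hG
      exact ⟨a₁, by rw [← ha₁]; exact (Nat.card_congr Multiplicative.toAdd).symm⟩
    refine ⟨a₁ + (2 * ν + ∑ w ∈ T, padicValNat p ((W.baseChange (w.adicCompletion ℚ)).localTamagawaNumber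
      (w.adicCompletionIntegers ℚ))), ?_⟩
    rw [hN, ha₁, Finset.prod_pow_eq_pow_sum, ← pow_add, ← pow_add]
  obtain ⟨a, ha⟩ := hNpow
  rw [hcard, ha] at hu
  rw [hb] at hu ⊢
  rw [ha]
  -- valuation bookkeeping: `ord_p f(0) + b = a`
  have h0 : PowerSeries.constantCoeff f ≠ 0 := (hord0 f hf).2
  have hp0 : (p : ℤ_[p]) ≠ 0 := NeZero.ne _
  rw [Nat.cast_pow, Nat.cast_pow] at hu
  have hv := congrArg PadicInt.valuation hu
  rw [PadicInt.valuation_mul h0 (pow_ne_zero _ hp0), PadicInt.valuation_mul u.ne_zero (pow_ne_zero _ hp0),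
    PadicInt.valuation_pow, PadicInt.valuation_pow, PadicInt.valuation_p, mul_one, mul_one] at hv
  have hu0 : PadicInt.valuation (u : ℤ_[p]) = 0 := by
    have h1 := valuation_coe_units_eq_zero p u
    rw [PadicInt.valuation_coe] at h1
    exact_mod_cast h1
  rw [hu0, zero_add] at hv
  rw [← pow_add]
  exact congrArg (fun n : ℕ ↦ p ^ n) hv

/-- **`p^{ord_p f(0)} ∣ #Ш(W)[p^∞] · p^{2ν} · ∏_{ℓ ∈ T} p^{ord_p c_ℓ(W)}` — ONE INEQUALITY of the Selmer
side of (C3_η) WITHOUT any no-finite-submodule input**: `ord_p f(0) ≤ ord_p #Ш(W)[p^∞] + 2ν + ∑ ord_p c_ℓ`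
for every strict-minus dual datum, in rank one, given `hPT` + `Ш(W)[p^∞]` finite + the generator of exact
level `ν` + `T`.  CONDITIONAL on `hPT`; nothing about (C1_η), (C2_η-GZ), (C3_η), `BSD(W, p)` claimed;
nothing booked. [cite: GreenbergLNM1716, §4 Thm. 4.1 and Lemma 4.2 (p. 102)] [cite: MilneADT2006, Ch. I, Thm. 4.10] -/
theorem pow_constantCoeff_dvd_card_sha_mul_of_quadraticTwist_signedPrime_rankOne
    {γ : absoluteGaloisGroup ℚ} (hγ : κ.IsTopGenerator γ) (D : StrictSignedSelmerDualData W κ ℚ_[p] γ (-1))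
    {f : IwasawaAlgebra p} (hf : D.charIdeal = Ideal.span {f}) :
    p ^ (((PowerSeries.constantCoeff f : ℤ_[p]) : ℚ_[p]).valuation).toNat ∣
      Nat.card (AddCommGroup.primaryComponent W.sha p) *
        (p ^ (2 * ν) * ∏ w ∈ T, p ^ padicValNat p ((W.baseChange (w.adicCompletion ℚ)).localTamagawaNumber
          (w.adicCompletionIntegers ℚ))) :=
  Dvd.intro _ (pow_constantCoeff_mul_natCard_invariants_eq_card_sha_mul_of_quadraticTwist_signedPrime_rankOne W κ
    hp2 hκ Cv V hCV hgood hap hPT P hP hgen hdiv hndiv T hpT hT hγ D hf)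

/-- **EQUALITY `#Ш(W)[p^∞] · p^{2ν} · ∏ p^{ord_p c_ℓ} = p^{ord_p f(0)}` holds IF AND ONLY IF `X^{−,str}[T] = 0`**
(equivalently `H¹(Γ, Sel^{−,str}(W/ℚ_∞)) = 0`), for every strict-minus dual datum in rank one given
`hPT` + `Ш(W)[p^∞]` finite + the generator of exact level `ν` + `T`: the Kitajima–Otsuki input of
file 119 is NECESSARY AND SUFFICIENT for the exact formula, and enters only through this one finite
group.  CONDITIONAL on `hPT`; nothing about (C1_η), (C2_η-GZ), (C3_η), `BSD(W, p)` claimed; nothing booked.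
[cite: GreenbergLNM1716, §4 Thm. 4.1 and Lemma 4.2 (p. 102)] [cite: KitajimaOtsuki2018, Main Thm. 1.3 (arXiv:1607.03612 p. 3)] -/
theorem card_sha_mul_eq_pow_iff_invariants_eq_bot_of_quadraticTwist_signedPrime_rankOne
    {γ : absoluteGaloisGroup ℚ} (hγ : κ.IsTopGenerator γ) (D : StrictSignedSelmerDualData W κ ℚ_[p] γ (-1))
    {f : IwasawaAlgebra p} (hf : D.charIdeal = Ideal.span {f}) :
    Nat.card (AddCommGroup.primaryComponent W.sha p) *
        (p ^ (2 * ν) * ∏ w ∈ T, p ^ padicValNat p ((W.baseChange (w.adicCompletion ℚ)).localTamagawaNumber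
          (w.adicCompletionIntegers ℚ))) =
      p ^ (((PowerSeries.constantCoeff f : ℤ_[p]) : ℚ_[p]).valuation).toNat ↔
    invariants p D.X = ⊥ := by
  have h := pow_constantCoeff_mul_natCard_invariants_eq_card_sha_mul_of_quadraticTwist_signedPrime_rankOne W κ
    hp2 hκ Cv V hCV hgood hap hPT P hP hgen hdiv hndiv T hpT hT hγ D hf
  obtain ⟨Q, hPQ⟩ := hdiv
  obtain ⟨hMF, hX, -⟩ := isTorsion_and_constantCoeff_ne_zero_of_quadraticTwist_signedPrime_rankOne W κ hp2
    hκ Cv V hCV hgood hap hPT P hP hgen hPQ hndiv T hpT hT hγ D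
  haveI := hMF
  haveI hAfin := finite_localPreimage_of_quadraticTwist_signedPrime_rankOne W κ hp2 hκ Cv V hCV
    hgood hap hPT P hP hgen hPQ hndiv T hpT hT hγ
  obtain ⟨hco, -, -⟩ :=
    StrictSignedControlZero.constantCoeff_mul_natCard_invariants_eq_of_quadraticTwist_signedPrime κ W (-1) hp2
      Cv V hCV hgood hap hγ D hX hf
  haveI hfinco : Finite (coinvariants p D.X) := Nat.finite_of_card_ne_zero (by rw [← hco]; exact Nat.card_pos.ne')
  haveI hfinI : Finite (invariants p D.X) := (finite_invariants_iff_finite_coinvariants p D.X hX).mpr hfinco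
  have hpow0 : 0 < p ^ (((PowerSeries.constantCoeff f : ℤ_[p]) : ℚ_[p]).valuation).toNat :=
    pow_pos hp.out.pos _
  constructor
  · intro heq
    rw [heq] at h
    have h1 : Nat.card (invariants p D.X) = 1 := by
      have := h; nth_rw 2 [← mul_one (p ^ _)] at this
      exact Nat.eq_of_mul_eq_mul_left hpow0 this
    rw [eq_bot_iff]
    intro x hx
    have hsub : Subsingleton (invariants p D.X) := (Nat.card_eq_one_iff_unique.mp h1).1
    rw [Submodule.mem_bot]
    have := hsub.elim ⟨x, hx⟩ ⟨0, Submodule.zero_mem _⟩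
    exact congrArg Subtype.val this
  · intro hbot
    rw [hbot] at h
    have h1 : Nat.card (⊥ : Submodule (IwasawaAlgebra p) D.X) = 1 := Nat.card_unique
    rw [h1, mul_one] at h
    exact h.symm

/-- **`hnf ⟹ X[T] = 0`**: a finitely generated torsion `Λ`-module with `char = (f)`, `f(0) ≠ 0`... here
concretely: if `X^{−,str}` has no non-trivial finite `Λ`-submodule then, `X[T]` being finite in rank one,
`X[T] = 0` — so the exact formula of file 119 is the case `X[T] = 0` of this file, and `hnf` enters
(C3_η)'s Selmer side ONLY here.  CONDITIONAL on `hPT`; nothing booked.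
[cite: GreenbergLNM1716, §4 Lemma 4.2 (p. 102)] [cite: KitajimaOtsuki2018, Main Thm. 1.3 (arXiv:1607.03612 p. 3)] -/
theorem invariants_eq_bot_of_noFiniteSubmodule_of_quadraticTwist_signedPrime_rankOne
    {γ : absoluteGaloisGroup ℚ} (hγ : κ.IsTopGenerator γ) (D : StrictSignedSelmerDualData W κ ℚ_[p] γ (-1))
    (hnf : ∀ N : Submodule (IwasawaAlgebra p) D.X, Finite N → N = ⊥) :
    invariants p D.X = ⊥ := by
  obtain ⟨Q, hPQ⟩ := hdiv
  obtain ⟨hMF, hX, -⟩ := isTorsion_and_constantCoeff_ne_zero_of_quadraticTwist_signedPrime_rankOne W κ hp2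
    hκ Cv V hCV hgood hap hPT P hP hgen hPQ hndiv T hpT hT hγ D
  haveI := hMF
  haveI hAfin := finite_localPreimage_of_quadraticTwist_signedPrime_rankOne W κ hp2 hκ Cv V hCV
    hgood hap hPT P hP hgen hPQ hndiv T hpT hT hγ
  obtain ⟨f, hf⟩ := SubSelmerControlZero.exists_charIdeal_eq_span p D.X
  obtain ⟨hco, -, -⟩ :=
    StrictSignedControlZero.constantCoeff_mul_natCard_invariants_eq_of_quadraticTwist_signedPrime κ W (-1) hp2
      Cv V hCV hgood hap hγ D hX hf
  haveI hfinco : Finite (coinvariants p D.X) := Nat.finite_of_card_ne_zero (by rw [← hco]; exact Nat.card_pos.ne')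
  have hfinI : Finite (invariants p D.X) := (finite_invariants_iff_finite_coinvariants p D.X hX).mpr hfinco
  exact hnf _ hfinI

/-- **File 119 recovered as the case `X[T] = 0`**: under `hnf` (Kitajima–Otsuki read on `D`),
`#Ш(W)[p^∞] · (p^{2ν} · ∏_{ℓ ∈ T} p^{ord_p c_ℓ(W)}) = p^{ord_p f(0)}` — consistency of this file with file
119's `card_sha_mul_eq_pow_of_quadraticTwist_signedPrime_rankOne_of_finite_sha`, by a different proof
(through `#A₀` and `X[T]`, not through file 108).  CONDITIONAL on `hPT` and `hnf`; nothing booked.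
[cite: GreenbergLNM1716, §4 Thm. 4.1 and Lemma 4.2 (p. 102)] [cite: KitajimaOtsuki2018, Main Thm. 1.3 (arXiv:1607.03612 p. 3)] -/
theorem card_sha_mul_eq_pow_of_noFiniteSubmodule_of_quadraticTwist_signedPrime_rankOne
    {γ : absoluteGaloisGroup ℚ} (hγ : κ.IsTopGenerator γ) (D : StrictSignedSelmerDualData W κ ℚ_[p] γ (-1))
    (hnf : ∀ N : Submodule (IwasawaAlgebra p) D.X, Finite N → N = ⊥)
    {f : IwasawaAlgebra p} (hf : D.charIdeal = Ideal.span {f}) :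
    Nat.card (AddCommGroup.primaryComponent W.sha p) *
        (p ^ (2 * ν) * ∏ w ∈ T, p ^ padicValNat p ((W.baseChange (w.adicCompletion ℚ)).localTamagawaNumber
          (w.adicCompletionIntegers ℚ))) =
      p ^ (((PowerSeries.constantCoeff f : ℤ_[p]) : ℚ_[p]).valuation).toNat :=
  (card_sha_mul_eq_pow_iff_invariants_eq_bot_of_quadraticTwist_signedPrime_rankOne W κ hp2 hκ Cv V hCV hgood hap
    hPT P hP hgen hdiv hndiv T hpT hT hγ D hf).mpr
    (invariants_eq_bot_of_noFiniteSubmodule_of_quadraticTwist_signedPrime_rankOne W κ hp2 hκ Cv V hCV hgood hap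
      hPT P hP hgen hdiv hndiv T hpT hT hγ D hnf)

end RankOne

end Summit.BirchSwinnertonDyer.Rank1Residual.Additive.LevelBridge

end
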